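import Summits.HodgeConjecture.HodgeConjecture.Theorems.F0P3cStCharTSEllMassHOrbSplit   -- ★ (B2b) p852628 + ★ (B2a) p852595 (this seat): `H_v`-side = `U₂`-side volume-normalised orbital integrals of product levels
import Literature.NumberTheory.Rogawski1990.RankOneEulerPoincareNonsplitRelations       -- ★ (B1) p852624 (LH7-p04): `exists_epRelations_nonsplit` — Kottwitz's (E)∕(N) on `U(Φ₂)(L⁺_v)`
import Literature.NumberTheory.Rogawski1990.RankOneEulerPoincareGlue                     -- ★ `isLocSmooth_epCombination`, `classOrbitalIntegral_const_smul`
import Literature.NumberTheory.Automorphic.LocalUnitaryGroupUnimodularIsotropic           -- ★ `isMulRightInvariant_cmDatum_local_antidiagOne` (every Haar on `U(Φ₂)_v` is right invariant)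
import Literature.NumberTheory.Automorphic.OrbitalMeasureCanonicalAtPoint                -- ★ `apply_out_conjClassesMk_of_forall_conj`
import Literature.MeasureTheory.Group.ConjClassClosedEmbedding                           -- ★ generic `orbitalIntegral_add_of_isClosed`
import HarnessLib

/-!
# F0 · P3c · line LH6 «StCharTS» — road «M5-H» (LEAD T14-41), brick (B3) «EP-H»: Kottwitz's Euler–Poincaré function ON `H_v = U(Φ₂)(L⁺_v) × U(Φ₁)(L⁺_v)` —
# a test function of total mass ONE whose canonical orbital integral is `1` at every elliptic `G`-regular class and `0` at every split `G`-regular class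
# [Kottwitz1988, §2 Thm. 2; Rogawski1990, §12.6 p. 187 («pseudo-coefficient» of `𝟙`); Laumon1996, (5.3.2)]

Cell `pub/hodgecm-mathlib`, crux H413 = `stmt-HodgeConjecture-24833` (lane `--supports … --as helper`), route HCCMUnconditional; seat F0P3a-p04 (g29), ROAD «M5-H» holder
(desk HANDS 2026-09-02T20:05:55Z: (B3) = holder; sigsheet 20:17:15Z).  THEOREMS ONLY (no definition ∕ instance ∕ notation ∕ named fact ∕ `sorry`); ★-only imports.

WHAT (LEAD fence (β), EP INPUT BY NAME).  `exists_epFunction_H`: for every Haar `νHv` on `H_v` and every family `mHv` canonical for (`IsLocalGRegular`, `νHv`) there is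
`f_H ∈ C_c^∞(H_v)` — explicitly `f_H := νHv(K⋆)⁻¹𝟙_{K⋆} + νHv(K′⋆)⁻¹𝟙_{K′⋆} − νHv(I⋆)⁻¹𝟙_{I⋆}`, `C⋆ := C × U(Φ₁)(L⁺_v)` — measurable, integrable, of MASS ONE, with
`Φ_H(⟦γ_H⟧, f_H) = 1` when `Z_H(γ_H)` is compact and `= 0` when it is not (`γ_H` `G`-regular).  The levels `K, K′, I ≤ U₂ = U(Φ₂)(L⁺_v)` and Kottwitz's two relations — (E)
`#Fix K + #Fix K′ = #Fix I + 1` at elliptic regular classes, (N) `Σ ± ν₂(C)⁻¹ Φ_{U₂}(𝟙_C) = 0` at split regular classes — are ★ (B1) `exists_epRelations_nonsplit` (LH7-p04 (g10),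
p852624: the internal assembly of ★ `rankOneEulerPoincareNonsplit_holds` AS A THEOREM, every non-split `v`, dyadic included) at an auxiliary Haar measure `ν₂` and canonical family `m₂`
on `U₂` (★ `OrbitalMeasureFamily.exists_isCanonical`, ★ `forall_isRegularElt_exists_isHaarMeasure_compactCore_centralizer_local_eq_one`, ★ `isMulRightInvariant_cmDatum_local_antidiagOne`);
the `H_v`-INSTANCE is ★ (B2a)∕(B2b) `classOrbitalIntegral_smul_indicator_prod_top_eq_U2_of_isLocalGRegular`: `Φ_H(⟦γ_H⟧, νHv(C⋆)⁻¹𝟙_{C⋆}; mHv) = Φ_{U₂}(⟦γ_H.1⟧, ν₂(C)⁻¹𝟙_C; m₂)`,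
so (E) gives `1` (★ `classOrbitalIntegral_smul_indicator_complex_local_eq_natCard_fixedBy` on `U₂`) and (N) gives `0`; compactness is exchanged between `Z_H(γ_H)` and `Z_{U₂}(γ_H.1)` by
★ (B2a) §1.  `∫ f_H dνHv = 1 + 1 − 1`.

* §1 `integral_const_mul_indicator_subgroup`, `integrable_const_mul_indicator_subgroup` — mass and integrability of `c · 𝟙_S` for a compact open subgroup `S ≤ H_v`;
  `classOrbitalIntegral_epCombination_H` — linearity of `Φ_H(⟦γ_H⟧, ·)` on the three-term combination at a `G`-regular class (closed orbit, generic ★ `orbitalIntegral_add_of_isClosed`).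
* §2 **`exists_epFunction_H`** — the head (the `fH`-binders of (B5-core) `ellipticWeylMass_H_eq_one_of_epFunction`, LH6-p04 (g7), token for token).
HONEST LABEL: count-neutral helper of «M5-H»; (M5) stays a PRINTED block consequent until (B5) is ★ and the (δ) rider consumes ★ (B6) `packetCharHNorm_of_ellipticWeylMass` (F0P3b-p01);
HC_CM is proved only modulo the 7 printed citations (2 remaining named inputs: hLiu418 = `stmt-HodgeConjecture-24832`, h413 = `stmt-HodgeConjecture-24833`) until rung 0 closes.

## References
* [Kottwitz1988] R. E. Kottwitz, *Tamagawa numbers*, Ann. of Math. 127 (1988), 629–646, §2 Theorem 2.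
* [Rogawski1990] J. D. Rogawski, *Automorphic Representations of Unitary Groups in Three Variables*, Ann. of Math. Stud. 123 (1990): §12.6 p. 187; §4.9 p. 54; §4.3 (4.3.1) p. 43.
* [Laumon1995] G. Laumon, *Cohomology of Drinfeld Modular Varieties* I (1996), Lemma (5.3.2) p. 136, Thm. (5.1.3).
-/

set_option autoImplicit false
-- the mandated namespace has the single-problem summit's repeated segment (`HodgeConjecture.HodgeConjecture`)
set_option linter.dupNamespace false

noncomputable section

open NumberField IsDedekindDomain MeasureTheory Measure Topology Set
open scoped Matrix MatrixGroups ENNReal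
open Literature.NumberTheory.Rogawski1990 Literature.NumberTheory.Automorphic Literature.NumberTheory.Automorphic.UnitaryGroup
open Literature.MeasureTheory.Group

namespace Summit.HodgeConjecture.HodgeConjecture.Cruxes.H413.F0P3cStCharTSEllMassHEP

section CM

variable (L : Type) [Field L] [NumberField L] [IsCMField L] (v : HeightOneSpectrum (𝓞 ↥(maximalRealSubfield L)))
  [MeasurableSpace ((UnitaryGroup.cmDatum L 2 (Matrix.of fun i j : Fin 2 => if i.val + j.val + 1 = 2 then (1 : L) else 0)).Local v ×
      (UnitaryGroup.cmDatum L 1 (Matrix.of fun i j : Fin 1 => if i.val + j.val + 1 = 1 then (1 : L) else 0)).Local v)] [BorelSpace ((UnitaryGroup.cmDatum L 2 (Matrix.of fun i j : Fin 2 => if i.val + j.val + 1 = 2 then (1 : L) else 0)).Local v ×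
      (UnitaryGroup.cmDatum L 1 (Matrix.of fun i j : Fin 1 => if i.val + j.val + 1 = 1 then (1 : L) else 0)).Local v)]
  [∀ a : ((UnitaryGroup.cmDatum L 2 (Matrix.of fun i j : Fin 2 => if i.val + j.val + 1 = 2 then (1 : L) else 0)).Local v ×
      (UnitaryGroup.cmDatum L 1 (Matrix.of fun i j : Fin 1 => if i.val + j.val + 1 = 1 then (1 : L) else 0)).Local v), MeasurableSpace (((UnitaryGroup.cmDatum L 2 (Matrix.of fun i j : Fin 2 => if i.val + j.val + 1 = 2 then (1 : L) else 0)).Local v ×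
      (UnitaryGroup.cmDatum L 1 (Matrix.of fun i j : Fin 1 => if i.val + j.val + 1 = 1 then (1 : L) else 0)).Local v) ⧸ Subgroup.centralizer ({a} : Set ((UnitaryGroup.cmDatum L 2 (Matrix.of fun i j : Fin 2 => if i.val + j.val + 1 = 2 then (1 : L) else 0)).Local v ×
      (UnitaryGroup.cmDatum L 1 (Matrix.of fun i j : Fin 1 => if i.val + j.val + 1 = 1 then (1 : L) else 0)).Local v)))]
  [∀ a : ((UnitaryGroup.cmDatum L 2 (Matrix.of fun i j : Fin 2 => if i.val + j.val + 1 = 2 then (1 : L) else 0)).Local v ×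
      (UnitaryGroup.cmDatum L 1 (Matrix.of fun i j : Fin 1 => if i.val + j.val + 1 = 1 then (1 : L) else 0)).Local v), BorelSpace (((UnitaryGroup.cmDatum L 2 (Matrix.of fun i j : Fin 2 => if i.val + j.val + 1 = 2 then (1 : L) else 0)).Local v ×
      (UnitaryGroup.cmDatum L 1 (Matrix.of fun i j : Fin 1 => if i.val + j.val + 1 = 1 then (1 : L) else 0)).Local v) ⧸ Subgroup.centralizer ({a} : Set ((UnitaryGroup.cmDatum L 2 (Matrix.of fun i j : Fin 2 => if i.val + j.val + 1 = 2 then (1 : L) else 0)).Local v ×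
      (UnitaryGroup.cmDatum L 1 (Matrix.of fun i j : Fin 1 => if i.val + j.val + 1 = 1 then (1 : L) else 0)).Local v)))]
  (νHv : Measure ((UnitaryGroup.cmDatum L 2 (Matrix.of fun i j : Fin 2 => if i.val + j.val + 1 = 2 then (1 : L) else 0)).Local v ×
      (UnitaryGroup.cmDatum L 1 (Matrix.of fun i j : Fin 1 => if i.val + j.val + 1 = 1 then (1 : L) else 0)).Local v)) [νHv.IsHaarMeasure] [νHv.IsMulRightInvariant]

/-! ## §1 Masses and linearity -/

omit [∀ a : ((UnitaryGroup.cmDatum L 2 (Matrix.of fun i j : Fin 2 => if i.val + j.val + 1 = 2 then (1 : L) else 0)).Local v ×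
      (UnitaryGroup.cmDatum L 1 (Matrix.of fun i j : Fin 1 => if i.val + j.val + 1 = 1 then (1 : L) else 0)).Local v), MeasurableSpace (((UnitaryGroup.cmDatum L 2 (Matrix.of fun i j : Fin 2 => if i.val + j.val + 1 = 2 then (1 : L) else 0)).Local v ×
      (UnitaryGroup.cmDatum L 1 (Matrix.of fun i j : Fin 1 => if i.val + j.val + 1 = 1 then (1 : L) else 0)).Local v) ⧸ Subgroup.centralizer ({a} : Set ((UnitaryGroup.cmDatum L 2 (Matrix.of fun i j : Fin 2 => if i.val + j.val + 1 = 2 then (1 : L) else 0)).Local v ×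
      (UnitaryGroup.cmDatum L 1 (Matrix.of fun i j : Fin 1 => if i.val + j.val + 1 = 1 then (1 : L) else 0)).Local v)))]
  [∀ a : ((UnitaryGroup.cmDatum L 2 (Matrix.of fun i j : Fin 2 => if i.val + j.val + 1 = 2 then (1 : L) else 0)).Local v ×
      (UnitaryGroup.cmDatum L 1 (Matrix.of fun i j : Fin 1 => if i.val + j.val + 1 = 1 then (1 : L) else 0)).Local v), BorelSpace (((UnitaryGroup.cmDatum L 2 (Matrix.of fun i j : Fin 2 => if i.val + j.val + 1 = 2 then (1 : L) else 0)).Local v ×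
      (UnitaryGroup.cmDatum L 1 (Matrix.of fun i j : Fin 1 => if i.val + j.val + 1 = 1 then (1 : L) else 0)).Local v) ⧸ Subgroup.centralizer ({a} : Set ((UnitaryGroup.cmDatum L 2 (Matrix.of fun i j : Fin 2 => if i.val + j.val + 1 = 2 then (1 : L) else 0)).Local v ×
      (UnitaryGroup.cmDatum L 1 (Matrix.of fun i j : Fin 1 => if i.val + j.val + 1 = 1 then (1 : L) else 0)).Local v)))] [νHv.IsHaarMeasure] [νHv.IsMulRightInvariant] in
/-- `∫ c · 𝟙_S dνHv = c · νHv(S)` for a compact open subgroup `S ≤ H_v`. [cite: Kottwitz1988, §2] -/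
theorem integral_const_mul_indicator_subgroup (S : Subgroup ((UnitaryGroup.cmDatum L 2 (Matrix.of fun i j : Fin 2 => if i.val + j.val + 1 = 2 then (1 : L) else 0)).Local v ×
      (UnitaryGroup.cmDatum L 1 (Matrix.of fun i j : Fin 1 => if i.val + j.val + 1 = 1 then (1 : L) else 0)).Local v)) (hSo : IsOpen (S : Set ((UnitaryGroup.cmDatum L 2 (Matrix.of fun i j : Fin 2 => if i.val + j.val + 1 = 2 then (1 : L) else 0)).Local v ×
      (UnitaryGroup.cmDatum L 1 (Matrix.of fun i j : Fin 1 => if i.val + j.val + 1 = 1 then (1 : L) else 0)).Local v))) (c : ℂ) :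
    ∫ g, c * (S : Set ((UnitaryGroup.cmDatum L 2 (Matrix.of fun i j : Fin 2 => if i.val + j.val + 1 = 2 then (1 : L) else 0)).Local v ×
      (UnitaryGroup.cmDatum L 1 (Matrix.of fun i j : Fin 1 => if i.val + j.val + 1 = 1 then (1 : L) else 0)).Local v)).indicator (fun _ => (1 : ℂ)) g ∂νHv = c * ((νHv S).toReal : ℂ) := by
  rw [integral_const_mul, integral_indicator_const (1 : ℂ) hSo.measurableSet, Complex.real_smul, mul_one]
  rfl

omit [∀ a : ((UnitaryGroup.cmDatum L 2 (Matrix.of fun i j : Fin 2 => if i.val + j.val + 1 = 2 then (1 : L) else 0)).Local v ×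
      (UnitaryGroup.cmDatum L 1 (Matrix.of fun i j : Fin 1 => if i.val + j.val + 1 = 1 then (1 : L) else 0)).Local v), MeasurableSpace (((UnitaryGroup.cmDatum L 2 (Matrix.of fun i j : Fin 2 => if i.val + j.val + 1 = 2 then (1 : L) else 0)).Local v ×
      (UnitaryGroup.cmDatum L 1 (Matrix.of fun i j : Fin 1 => if i.val + j.val + 1 = 1 then (1 : L) else 0)).Local v) ⧸ Subgroup.centralizer ({a} : Set ((UnitaryGroup.cmDatum L 2 (Matrix.of fun i j : Fin 2 => if i.val + j.val + 1 = 2 then (1 : L) else 0)).Local v ×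
      (UnitaryGroup.cmDatum L 1 (Matrix.of fun i j : Fin 1 => if i.val + j.val + 1 = 1 then (1 : L) else 0)).Local v)))]
  [∀ a : ((UnitaryGroup.cmDatum L 2 (Matrix.of fun i j : Fin 2 => if i.val + j.val + 1 = 2 then (1 : L) else 0)).Local v ×
      (UnitaryGroup.cmDatum L 1 (Matrix.of fun i j : Fin 1 => if i.val + j.val + 1 = 1 then (1 : L) else 0)).Local v), BorelSpace (((UnitaryGroup.cmDatum L 2 (Matrix.of fun i j : Fin 2 => if i.val + j.val + 1 = 2 then (1 : L) else 0)).Local v ×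
      (UnitaryGroup.cmDatum L 1 (Matrix.of fun i j : Fin 1 => if i.val + j.val + 1 = 1 then (1 : L) else 0)).Local v) ⧸ Subgroup.centralizer ({a} : Set ((UnitaryGroup.cmDatum L 2 (Matrix.of fun i j : Fin 2 => if i.val + j.val + 1 = 2 then (1 : L) else 0)).Local v ×
      (UnitaryGroup.cmDatum L 1 (Matrix.of fun i j : Fin 1 => if i.val + j.val + 1 = 1 then (1 : L) else 0)).Local v)))] [νHv.IsMulRightInvariant] in
/-- `c · 𝟙_S` is integrable for a compact open subgroup `S ≤ H_v`. [cite: Kottwitz1988, §2] -/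
theorem integrable_const_mul_indicator_subgroup (S : Subgroup ((UnitaryGroup.cmDatum L 2 (Matrix.of fun i j : Fin 2 => if i.val + j.val + 1 = 2 then (1 : L) else 0)).Local v ×
      (UnitaryGroup.cmDatum L 1 (Matrix.of fun i j : Fin 1 => if i.val + j.val + 1 = 1 then (1 : L) else 0)).Local v)) (hSo : IsOpen (S : Set ((UnitaryGroup.cmDatum L 2 (Matrix.of fun i j : Fin 2 => if i.val + j.val + 1 = 2 then (1 : L) else 0)).Local v ×
      (UnitaryGroup.cmDatum L 1 (Matrix.of fun i j : Fin 1 => if i.val + j.val + 1 = 1 then (1 : L) else 0)).Local v))) (hSc : IsCompact (S : Set ((UnitaryGroup.cmDatum L 2 (Matrix.of fun i j : Fin 2 => if i.val + j.val + 1 = 2 then (1 : L) else 0)).Local v ×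
      (UnitaryGroup.cmDatum L 1 (Matrix.of fun i j : Fin 1 => if i.val + j.val + 1 = 1 then (1 : L) else 0)).Local v))) (c : ℂ) :
    Integrable (fun g => c * (S : Set ((UnitaryGroup.cmDatum L 2 (Matrix.of fun i j : Fin 2 => if i.val + j.val + 1 = 2 then (1 : L) else 0)).Local v ×
      (UnitaryGroup.cmDatum L 1 (Matrix.of fun i j : Fin 1 => if i.val + j.val + 1 = 1 then (1 : L) else 0)).Local v)).indicator (fun _ => (1 : ℂ)) g) νHv :=
  (((isLocSmooth_indicator_subgroup S hSo hSc).continuous.integrable_of_hasCompactSupport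
    (isLocSmooth_indicator_subgroup S hSo hSc).hasCompactSupport)).const_mul c

/-- **Linearity of `Φ_H(⟦γ_H⟧, ·)` on a three-term combination of scaled indicators of compact open subgroups** at a `G`-regular class (its orbit is closed, ★
`isClosed_conjClass_localH_of_isLocalGRegular`; the canonical member is finite on compacts; ★ generic `orbitalIntegral_add_of_isClosed` at the representative).
[cite: Rogawski1990, §4.9 p. 54] [cite: Kottwitz1988, §2] -/
theorem classOrbitalIntegral_epCombination_H
    {mHv : OrbitalMeasureFamily ((UnitaryGroup.cmDatum L 2 (Matrix.of fun i j : Fin 2 => if i.val + j.val + 1 = 2 then (1 : L) else 0)).Local v ×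
      (UnitaryGroup.cmDatum L 1 (Matrix.of fun i j : Fin 1 => if i.val + j.val + 1 = 1 then (1 : L) else 0)).Local v)} (hcanH : mHv.IsCanonical (IsLocalGRegular L v) νHv)
    (S₁ S₂ S₃ : Subgroup ((UnitaryGroup.cmDatum L 2 (Matrix.of fun i j : Fin 2 => if i.val + j.val + 1 = 2 then (1 : L) else 0)).Local v ×
      (UnitaryGroup.cmDatum L 1 (Matrix.of fun i j : Fin 1 => if i.val + j.val + 1 = 1 then (1 : L) else 0)).Local v))
    (h₁o : IsOpen (S₁ : Set ((UnitaryGroup.cmDatum L 2 (Matrix.of fun i j : Fin 2 => if i.val + j.val + 1 = 2 then (1 : L) else 0)).Local v ×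
      (UnitaryGroup.cmDatum L 1 (Matrix.of fun i j : Fin 1 => if i.val + j.val + 1 = 1 then (1 : L) else 0)).Local v))) (h₁c : IsCompact (S₁ : Set ((UnitaryGroup.cmDatum L 2 (Matrix.of fun i j : Fin 2 => if i.val + j.val + 1 = 2 then (1 : L) else 0)).Local v ×
      (UnitaryGroup.cmDatum L 1 (Matrix.of fun i j : Fin 1 => if i.val + j.val + 1 = 1 then (1 : L) else 0)).Local v)))
    (h₂o : IsOpen (S₂ : Set ((UnitaryGroup.cmDatum L 2 (Matrix.of fun i j : Fin 2 => if i.val + j.val + 1 = 2 then (1 : L) else 0)).Local v ×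
      (UnitaryGroup.cmDatum L 1 (Matrix.of fun i j : Fin 1 => if i.val + j.val + 1 = 1 then (1 : L) else 0)).Local v))) (h₂c : IsCompact (S₂ : Set ((UnitaryGroup.cmDatum L 2 (Matrix.of fun i j : Fin 2 => if i.val + j.val + 1 = 2 then (1 : L) else 0)).Local v ×
      (UnitaryGroup.cmDatum L 1 (Matrix.of fun i j : Fin 1 => if i.val + j.val + 1 = 1 then (1 : L) else 0)).Local v)))
    (h₃o : IsOpen (S₃ : Set ((UnitaryGroup.cmDatum L 2 (Matrix.of fun i j : Fin 2 => if i.val + j.val + 1 = 2 then (1 : L) else 0)).Local v ×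
      (UnitaryGroup.cmDatum L 1 (Matrix.of fun i j : Fin 1 => if i.val + j.val + 1 = 1 then (1 : L) else 0)).Local v))) (h₃c : IsCompact (S₃ : Set ((UnitaryGroup.cmDatum L 2 (Matrix.of fun i j : Fin 2 => if i.val + j.val + 1 = 2 then (1 : L) else 0)).Local v ×
      (UnitaryGroup.cmDatum L 1 (Matrix.of fun i j : Fin 1 => if i.val + j.val + 1 = 1 then (1 : L) else 0)).Local v)))
    (a b c : ℂ) (γH : ((UnitaryGroup.cmDatum L 2 (Matrix.of fun i j : Fin 2 => if i.val + j.val + 1 = 2 then (1 : L) else 0)).Local v ×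
      (UnitaryGroup.cmDatum L 1 (Matrix.of fun i j : Fin 1 => if i.val + j.val + 1 = 1 then (1 : L) else 0)).Local v)) (hγ : IsLocalGRegular L v γH) :
    classOrbitalIntegral mHv (fun g => a * (S₁ : Set ((UnitaryGroup.cmDatum L 2 (Matrix.of fun i j : Fin 2 => if i.val + j.val + 1 = 2 then (1 : L) else 0)).Local v ×
      (UnitaryGroup.cmDatum L 1 (Matrix.of fun i j : Fin 1 => if i.val + j.val + 1 = 1 then (1 : L) else 0)).Local v)).indicator (fun _ => (1 : ℂ)) g + b * (S₂ : Set ((UnitaryGroup.cmDatum L 2 (Matrix.of fun i j : Fin 2 => if i.val + j.val + 1 = 2 then (1 : L) else 0)).Local v ×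
      (UnitaryGroup.cmDatum L 1 (Matrix.of fun i j : Fin 1 => if i.val + j.val + 1 = 1 then (1 : L) else 0)).Local v)).indicator (fun _ => (1 : ℂ)) g -
        c * (S₃ : Set ((UnitaryGroup.cmDatum L 2 (Matrix.of fun i j : Fin 2 => if i.val + j.val + 1 = 2 then (1 : L) else 0)).Local v ×
      (UnitaryGroup.cmDatum L 1 (Matrix.of fun i j : Fin 1 => if i.val + j.val + 1 = 1 then (1 : L) else 0)).Local v)).indicator (fun _ => (1 : ℂ)) g) (ConjClasses.mk γH) =
      classOrbitalIntegral mHv (fun g => a * (S₁ : Set ((UnitaryGroup.cmDatum L 2 (Matrix.of fun i j : Fin 2 => if i.val + j.val + 1 = 2 then (1 : L) else 0)).Local v ×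
      (UnitaryGroup.cmDatum L 1 (Matrix.of fun i j : Fin 1 => if i.val + j.val + 1 = 1 then (1 : L) else 0)).Local v)).indicator (fun _ => (1 : ℂ)) g) (ConjClasses.mk γH) +
        classOrbitalIntegral mHv (fun g => b * (S₂ : Set ((UnitaryGroup.cmDatum L 2 (Matrix.of fun i j : Fin 2 => if i.val + j.val + 1 = 2 then (1 : L) else 0)).Local v ×
      (UnitaryGroup.cmDatum L 1 (Matrix.of fun i j : Fin 1 => if i.val + j.val + 1 = 1 then (1 : L) else 0)).Local v)).indicator (fun _ => (1 : ℂ)) g) (ConjClasses.mk γH) -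
        classOrbitalIntegral mHv (fun g => c * (S₃ : Set ((UnitaryGroup.cmDatum L 2 (Matrix.of fun i j : Fin 2 => if i.val + j.val + 1 = 2 then (1 : L) else 0)).Local v ×
      (UnitaryGroup.cmDatum L 1 (Matrix.of fun i j : Fin 1 => if i.val + j.val + 1 = 1 then (1 : L) else 0)).Local v)).indicator (fun _ => (1 : ℂ)) g) (ConjClasses.mk γH) := by
  have hP : ∀ g x : ((UnitaryGroup.cmDatum L 2 (Matrix.of fun i j : Fin 2 => if i.val + j.val + 1 = 2 then (1 : L) else 0)).Local v ×
      (UnitaryGroup.cmDatum L 1 (Matrix.of fun i j : Fin 1 => if i.val + j.val + 1 = 1 then (1 : L) else 0)).Local v), IsLocalGRegular L v g → IsLocalGRegular L v (x * g * x⁻¹) := fun _ x hg => isLocalGRegular_of_isConj (isConj_iff.2 ⟨x, rfl⟩) hg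
  -- the representative of the class and its closed orbit; the canonical member is finite on compacts
  have hout : IsLocalGRegular L v (Quotient.out (ConjClasses.mk γH)) := apply_out_conjClassesMk_of_forall_conj hP hγ
  have hO := isClosed_conjClass_localH_of_isLocalGRegular L v (Quotient.out (ConjClasses.mk γH)) hout
  obtain ⟨-, -, hfin⟩ := hcanH.isAdmissibleOn (ConjClasses.mk γH) hout
  haveI := hfin
  -- the three scaled indicators are continuous with compact support
  have hs₁ := (isLocSmooth_indicator_subgroup S₁ h₁o h₁c).const_smul a
  have hs₂ := (isLocSmooth_indicator_subgroup S₂ h₂o h₂c).const_smul b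
  have hs₃ := (isLocSmooth_indicator_subgroup S₃ h₃o h₃c).const_smul c
  have e₁ : (fun g => a * (S₁ : Set ((UnitaryGroup.cmDatum L 2 (Matrix.of fun i j : Fin 2 => if i.val + j.val + 1 = 2 then (1 : L) else 0)).Local v ×
      (UnitaryGroup.cmDatum L 1 (Matrix.of fun i j : Fin 1 => if i.val + j.val + 1 = 1 then (1 : L) else 0)).Local v)).indicator (fun _ => (1 : ℂ)) g) = a • (S₁ : Set ((UnitaryGroup.cmDatum L 2 (Matrix.of fun i j : Fin 2 => if i.val + j.val + 1 = 2 then (1 : L) else 0)).Local v ×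
      (UnitaryGroup.cmDatum L 1 (Matrix.of fun i j : Fin 1 => if i.val + j.val + 1 = 1 then (1 : L) else 0)).Local v)).indicator (fun _ => (1 : ℂ)) := by
    funext g; rw [Pi.smul_apply, smul_eq_mul]
  have e₂ : (fun g => b * (S₂ : Set ((UnitaryGroup.cmDatum L 2 (Matrix.of fun i j : Fin 2 => if i.val + j.val + 1 = 2 then (1 : L) else 0)).Local v ×
      (UnitaryGroup.cmDatum L 1 (Matrix.of fun i j : Fin 1 => if i.val + j.val + 1 = 1 then (1 : L) else 0)).Local v)).indicator (fun _ => (1 : ℂ)) g) = b • (S₂ : Set ((UnitaryGroup.cmDatum L 2 (Matrix.of fun i j : Fin 2 => if i.val + j.val + 1 = 2 then (1 : L) else 0)).Local v ×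
      (UnitaryGroup.cmDatum L 1 (Matrix.of fun i j : Fin 1 => if i.val + j.val + 1 = 1 then (1 : L) else 0)).Local v)).indicator (fun _ => (1 : ℂ)) := by
    funext g; rw [Pi.smul_apply, smul_eq_mul]
  have e₃ : (fun g => c * (S₃ : Set ((UnitaryGroup.cmDatum L 2 (Matrix.of fun i j : Fin 2 => if i.val + j.val + 1 = 2 then (1 : L) else 0)).Local v ×
      (UnitaryGroup.cmDatum L 1 (Matrix.of fun i j : Fin 1 => if i.val + j.val + 1 = 1 then (1 : L) else 0)).Local v)).indicator (fun _ => (1 : ℂ)) g) = c • (S₃ : Set ((UnitaryGroup.cmDatum L 2 (Matrix.of fun i j : Fin 2 => if i.val + j.val + 1 = 2 then (1 : L) else 0)).Local v ×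
      (UnitaryGroup.cmDatum L 1 (Matrix.of fun i j : Fin 1 => if i.val + j.val + 1 = 1 then (1 : L) else 0)).Local v)).indicator (fun _ => (1 : ℂ)) := by
    funext g; rw [Pi.smul_apply, smul_eq_mul]
  have esum : (fun g => a * (S₁ : Set ((UnitaryGroup.cmDatum L 2 (Matrix.of fun i j : Fin 2 => if i.val + j.val + 1 = 2 then (1 : L) else 0)).Local v ×
      (UnitaryGroup.cmDatum L 1 (Matrix.of fun i j : Fin 1 => if i.val + j.val + 1 = 1 then (1 : L) else 0)).Local v)).indicator (fun _ => (1 : ℂ)) g + b * (S₂ : Set ((UnitaryGroup.cmDatum L 2 (Matrix.of fun i j : Fin 2 => if i.val + j.val + 1 = 2 then (1 : L) else 0)).Local v ×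
      (UnitaryGroup.cmDatum L 1 (Matrix.of fun i j : Fin 1 => if i.val + j.val + 1 = 1 then (1 : L) else 0)).Local v)).indicator (fun _ => (1 : ℂ)) g -
        c * (S₃ : Set ((UnitaryGroup.cmDatum L 2 (Matrix.of fun i j : Fin 2 => if i.val + j.val + 1 = 2 then (1 : L) else 0)).Local v ×
      (UnitaryGroup.cmDatum L 1 (Matrix.of fun i j : Fin 1 => if i.val + j.val + 1 = 1 then (1 : L) else 0)).Local v)).indicator (fun _ => (1 : ℂ)) g) =
      (a • (S₁ : Set ((UnitaryGroup.cmDatum L 2 (Matrix.of fun i j : Fin 2 => if i.val + j.val + 1 = 2 then (1 : L) else 0)).Local v ×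
      (UnitaryGroup.cmDatum L 1 (Matrix.of fun i j : Fin 1 => if i.val + j.val + 1 = 1 then (1 : L) else 0)).Local v)).indicator (fun _ => (1 : ℂ)) + b • (S₂ : Set ((UnitaryGroup.cmDatum L 2 (Matrix.of fun i j : Fin 2 => if i.val + j.val + 1 = 2 then (1 : L) else 0)).Local v ×
      (UnitaryGroup.cmDatum L 1 (Matrix.of fun i j : Fin 1 => if i.val + j.val + 1 = 1 then (1 : L) else 0)).Local v)).indicator (fun _ => (1 : ℂ))) +
        (-(c • (S₃ : Set ((UnitaryGroup.cmDatum L 2 (Matrix.of fun i j : Fin 2 => if i.val + j.val + 1 = 2 then (1 : L) else 0)).Local v ×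
      (UnitaryGroup.cmDatum L 1 (Matrix.of fun i j : Fin 1 => if i.val + j.val + 1 = 1 then (1 : L) else 0)).Local v)).indicator (fun _ => (1 : ℂ)))) := by
    funext g; simp only [Pi.add_apply, Pi.neg_apply, Pi.smul_apply, smul_eq_mul]; ring
  rw [esum, e₁, e₂, e₃, classOrbitalIntegral_eq, classOrbitalIntegral_eq, classOrbitalIntegral_eq, classOrbitalIntegral_eq,
    orbitalIntegral_add_of_isClosed _ _ hO (hs₁.add hs₂).continuous (hs₁.add hs₂).hasCompactSupport hs₃.neg.continuous hs₃.neg.hasCompactSupport,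
    orbitalIntegral_add_of_isClosed _ _ hO hs₁.continuous hs₁.hasCompactSupport hs₂.continuous hs₂.hasCompactSupport, orbitalIntegral_neg, sub_eq_add_neg]

/-! ## §2 The Euler–Poincaré function on `H_v` -/

set_option maxHeartbeats 1600000 in
set_option synthInstance.maxHeartbeats 400000 in
-- instance-term unification across the `cmDatum` ∕ `«local»` spellings of `U(Φ₂)(L⁺_v)` (as ★ (H5)∕(H5′))
/-- **KOTTWITZ'S EULER–POINCARÉ FUNCTION ON `H_v = U(Φ₂)(L⁺_v) × U(Φ₁)(L⁺_v)`** (`v` non-split, dyadic included): for every Haar measure `νHv` on `H_v` and every family `mHv`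
canonical for (`IsLocalGRegular`, `νHv`) there is `f_H : H_v → ℂ`, locally constant with compact support, measurable, integrable, with `∫ f_H dνHv = 1`, whose canonical
orbital integral is `1` at every `G`-regular class with COMPACT centraliser and `0` at every `G`-regular class with NON-compact centraliser.  EP input BY NAME: ★ (B1)
`exists_epRelations_nonsplit` (relations (E)∕(N) on `U₂`), ★ (B2a)∕(B2b) (`H_v ↔ U₂` orbital integrals of product levels).
[cite: Kottwitz1988, §2 Theorem 2] [cite: Rogawski1990, §12.6 p. 187] [cite: Laumon1995, Thm. (5.1.3), Lemma (5.3.2) p. 136] -/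
theorem exists_epFunction_H (hns : ∀ w : PlacesOver L v, IsCMField.complexConj L • w.1 = w.1)
    {mHv : OrbitalMeasureFamily ((UnitaryGroup.cmDatum L 2 (Matrix.of fun i j : Fin 2 => if i.val + j.val + 1 = 2 then (1 : L) else 0)).Local v ×
      (UnitaryGroup.cmDatum L 1 (Matrix.of fun i j : Fin 1 => if i.val + j.val + 1 = 1 then (1 : L) else 0)).Local v)} (hcanH : mHv.IsCanonical (IsLocalGRegular L v) νHv) :
    ∃ fH : ((UnitaryGroup.cmDatum L 2 (Matrix.of fun i j : Fin 2 => if i.val + j.val + 1 = 2 then (1 : L) else 0)).Local v ×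
      (UnitaryGroup.cmDatum L 1 (Matrix.of fun i j : Fin 1 => if i.val + j.val + 1 = 1 then (1 : L) else 0)).Local v) → ℂ, IsLocSmooth fH ∧ Measurable fH ∧ Integrable fH νHv ∧ ∫ h, fH h ∂νHv = 1 ∧
      (∀ γH : ((UnitaryGroup.cmDatum L 2 (Matrix.of fun i j : Fin 2 => if i.val + j.val + 1 = 2 then (1 : L) else 0)).Local v ×
      (UnitaryGroup.cmDatum L 1 (Matrix.of fun i j : Fin 1 => if i.val + j.val + 1 = 1 then (1 : L) else 0)).Local v), IsLocalGRegular L v γH → IsCompact ((Subgroup.centralizer ({γH} : Set ((UnitaryGroup.cmDatum L 2 (Matrix.of fun i j : Fin 2 => if i.val + j.val + 1 = 2 then (1 : L) else 0)).Local v ×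
      (UnitaryGroup.cmDatum L 1 (Matrix.of fun i j : Fin 1 => if i.val + j.val + 1 = 1 then (1 : L) else 0)).Local v)) : Subgroup ((UnitaryGroup.cmDatum L 2 (Matrix.of fun i j : Fin 2 => if i.val + j.val + 1 = 2 then (1 : L) else 0)).Local v ×
      (UnitaryGroup.cmDatum L 1 (Matrix.of fun i j : Fin 1 => if i.val + j.val + 1 = 1 then (1 : L) else 0)).Local v)) : Set ((UnitaryGroup.cmDatum L 2 (Matrix.of fun i j : Fin 2 => if i.val + j.val + 1 = 2 then (1 : L) else 0)).Local v ×
      (UnitaryGroup.cmDatum L 1 (Matrix.of fun i j : Fin 1 => if i.val + j.val + 1 = 1 then (1 : L) else 0)).Local v)) →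
        classOrbitalIntegral mHv fH (ConjClasses.mk γH) = 1) ∧
      (∀ γH : ((UnitaryGroup.cmDatum L 2 (Matrix.of fun i j : Fin 2 => if i.val + j.val + 1 = 2 then (1 : L) else 0)).Local v ×
      (UnitaryGroup.cmDatum L 1 (Matrix.of fun i j : Fin 1 => if i.val + j.val + 1 = 1 then (1 : L) else 0)).Local v), IsLocalGRegular L v γH → ¬ IsCompact ((Subgroup.centralizer ({γH} : Set ((UnitaryGroup.cmDatum L 2 (Matrix.of fun i j : Fin 2 => if i.val + j.val + 1 = 2 then (1 : L) else 0)).Local v ×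
      (UnitaryGroup.cmDatum L 1 (Matrix.of fun i j : Fin 1 => if i.val + j.val + 1 = 1 then (1 : L) else 0)).Local v)) : Subgroup ((UnitaryGroup.cmDatum L 2 (Matrix.of fun i j : Fin 2 => if i.val + j.val + 1 = 2 then (1 : L) else 0)).Local v ×
      (UnitaryGroup.cmDatum L 1 (Matrix.of fun i j : Fin 1 => if i.val + j.val + 1 = 1 then (1 : L) else 0)).Local v)) : Set ((UnitaryGroup.cmDatum L 2 (Matrix.of fun i j : Fin 2 => if i.val + j.val + 1 = 2 then (1 : L) else 0)).Local v ×
      (UnitaryGroup.cmDatum L 1 (Matrix.of fun i j : Fin 1 => if i.val + j.val + 1 = 1 then (1 : L) else 0)).Local v)) →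
        classOrbitalIntegral mHv fH (ConjClasses.mk γH) = 0) := by
  obtain ⟨w⟩ : Nonempty (PlacesOver L v) := inferInstance
  have hw : IsCMField.complexConj L • w.1 = w.1 := hns w
  haveI : Algebra.IsQuadraticExtension ↥(maximalRealSubfield L) L := IsCMField.isQuadraticExtension L
  haveI hvs : Subsingleton (PlacesOver L v) := PlacesOver.subsingleton_of_smul_eq (IsCMField.complexConj L) (IsCMField.complexConj_ne_one L) w hw
  have hc1 : IsCMField.complexConj L ≠ 1 := IsCMField.complexConj_ne_one L
  -- an auxiliary Haar measure and canonical family on `U₂`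
  letI iM₂ : MeasurableSpace ((UnitaryGroup.cmDatum L 2 (Matrix.of fun i j : Fin 2 => if i.val + j.val + 1 = 2 then (1 : L) else 0)).Local v) := borel _
  haveI : BorelSpace ((UnitaryGroup.cmDatum L 2 (Matrix.of fun i j : Fin 2 => if i.val + j.val + 1 = 2 then (1 : L) else 0)).Local v) := ⟨rfl⟩
  letI : ∀ γ : ((UnitaryGroup.cmDatum L 2 (Matrix.of fun i j : Fin 2 => if i.val + j.val + 1 = 2 then (1 : L) else 0)).Local v), MeasurableSpace (((UnitaryGroup.cmDatum L 2 (Matrix.of fun i j : Fin 2 => if i.val + j.val + 1 = 2 then (1 : L) else 0)).Local v) ⧸ Subgroup.centralizer ({γ} : Set ((UnitaryGroup.cmDatum L 2 (Matrix.of fun i j : Fin 2 => if i.val + j.val + 1 = 2 then (1 : L) else 0)).Local v))) := fun _ => borel _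
  haveI : ∀ γ : ((UnitaryGroup.cmDatum L 2 (Matrix.of fun i j : Fin 2 => if i.val + j.val + 1 = 2 then (1 : L) else 0)).Local v), BorelSpace (((UnitaryGroup.cmDatum L 2 (Matrix.of fun i j : Fin 2 => if i.val + j.val + 1 = 2 then (1 : L) else 0)).Local v) ⧸ Subgroup.centralizer ({γ} : Set ((UnitaryGroup.cmDatum L 2 (Matrix.of fun i j : Fin 2 => if i.val + j.val + 1 = 2 then (1 : L) else 0)).Local v))) := fun _ => ⟨rfl⟩
  -- the same structures on the `«local»` spelling of the carrier (★ `cmDatum_Local` is `rfl`), for the ★ lemmas stated there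
  letI : MeasurableSpace ↥(«local» L (IsCMField.complexConj L) 2 (Matrix.of fun i j : Fin 2 => if i.val + j.val + 1 = 2 then (1 : L) else 0) v) := iM₂
  haveI : BorelSpace ↥(«local» L (IsCMField.complexConj L) 2 (Matrix.of fun i j : Fin 2 => if i.val + j.val + 1 = 2 then (1 : L) else 0) v) := ⟨rfl⟩
  let ν₂ : Measure ((UnitaryGroup.cmDatum L 2 (Matrix.of fun i j : Fin 2 => if i.val + j.val + 1 = 2 then (1 : L) else 0)).Local v) := Measure.haar
  haveI : ν₂.IsMulRightInvariant := isMulRightInvariant_cmDatum_local_antidiagOne L 2 v ν₂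
  have ht₂ : ∀ γ : ((UnitaryGroup.cmDatum L 2 (Matrix.of fun i j : Fin 2 => if i.val + j.val + 1 = 2 then (1 : L) else 0)).Local v),
      IsRegularElt (γ.val : GL (Fin 2) (UnitaryGroup.LocalRing L v)) →
      ∃ t : Measure (Subgroup.centralizer ({γ} : Set ((UnitaryGroup.cmDatum L 2 (Matrix.of fun i j : Fin 2 => if i.val + j.val + 1 = 2 then (1 : L) else 0)).Local v))),
        t.IsHaarMeasure ∧ t.IsInvInvariant ∧ t (compactCore (Subgroup.centralizer ({γ} : Set ((UnitaryGroup.cmDatum L 2 (Matrix.of fun i j : Fin 2 => if i.val + j.val + 1 = 2 then (1 : L) else 0)).Local v)))) = 1 :=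
    fun γ hγ' => forall_isRegularElt_exists_isHaarMeasure_compactCore_centralizer_local_eq_one (IsCMField.complexConj L) 2 _ hc1
      (UnitaryGroup.antidiagOne_map_transpose (IsCMField.complexConj L) 2) (isUnit_antidiagOne_det L 2) γ hγ'
  obtain ⟨m₂, hcan₂⟩ := OrbitalMeasureFamily.exists_isCanonical (G := ((UnitaryGroup.cmDatum L 2 (Matrix.of fun i j : Fin 2 => if i.val + j.val + 1 = 2 then (1 : L) else 0)).Local v))
    (fun γ => IsRegularElt (γ.val : GL (Fin 2) (UnitaryGroup.LocalRing L v))) ν₂ ht₂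
  -- Kottwitz's two relations on `U₂` (★ (B1))
  obtain ⟨K, K', I, hKo, hKc, hK'o, hK'c, hIo, hIc, hE, hN⟩ := exists_epRelations_nonsplit L v hvs ν₂ m₂ hcan₂
  -- the product levels
  have hK := F0P3cStCharTSEllMassHOrbEll.isCompact_isOpen_coe_prod_top L v hns K hKo hKc
  have hK' := F0P3cStCharTSEllMassHOrbEll.isCompact_isOpen_coe_prod_top L v hns K' hK'o hK'c
  have hI := F0P3cStCharTSEllMassHOrbEll.isCompact_isOpen_coe_prod_top L v hns I hIo hIc
  -- volume factors are finite and non-zero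
  have hvol : ∀ S : Subgroup ((UnitaryGroup.cmDatum L 2 (Matrix.of fun i j : Fin 2 => if i.val + j.val + 1 = 2 then (1 : L) else 0)).Local v ×
      (UnitaryGroup.cmDatum L 1 (Matrix.of fun i j : Fin 1 => if i.val + j.val + 1 = 1 then (1 : L) else 0)).Local v), IsOpen (S : Set ((UnitaryGroup.cmDatum L 2 (Matrix.of fun i j : Fin 2 => if i.val + j.val + 1 = 2 then (1 : L) else 0)).Local v ×
      (UnitaryGroup.cmDatum L 1 (Matrix.of fun i j : Fin 1 => if i.val + j.val + 1 = 1 then (1 : L) else 0)).Local v)) → IsCompact (S : Set ((UnitaryGroup.cmDatum L 2 (Matrix.of fun i j : Fin 2 => if i.val + j.val + 1 = 2 then (1 : L) else 0)).Local v ×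
      (UnitaryGroup.cmDatum L 1 (Matrix.of fun i j : Fin 1 => if i.val + j.val + 1 = 1 then (1 : L) else 0)).Local v)) → ((νHv S).toReal : ℂ) ≠ 0 := fun S hSo hSc =>
    Complex.ofReal_ne_zero.2 (ENNReal.toReal_pos (hSo.measure_pos νHv ⟨1, S.one_mem⟩).ne' hSc.measure_lt_top.ne).ne'
  refine ⟨fun g => (((νHv ((K.prod ⊤ : Subgroup ((UnitaryGroup.cmDatum L 2 (Matrix.of fun i j : Fin 2 => if i.val + j.val + 1 = 2 then (1 : L) else 0)).Local v ×
      (UnitaryGroup.cmDatum L 1 (Matrix.of fun i j : Fin 1 => if i.val + j.val + 1 = 1 then (1 : L) else 0)).Local v)))).toReal : ℂ))⁻¹ * (((K.prod ⊤ : Subgroup ((UnitaryGroup.cmDatum L 2 (Matrix.of fun i j : Fin 2 => if i.val + j.val + 1 = 2 then (1 : L) else 0)).Local v ×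
      (UnitaryGroup.cmDatum L 1 (Matrix.of fun i j : Fin 1 => if i.val + j.val + 1 = 1 then (1 : L) else 0)).Local v))) : Set ((UnitaryGroup.cmDatum L 2 (Matrix.of fun i j : Fin 2 => if i.val + j.val + 1 = 2 then (1 : L) else 0)).Local v ×
      (UnitaryGroup.cmDatum L 1 (Matrix.of fun i j : Fin 1 => if i.val + j.val + 1 = 1 then (1 : L) else 0)).Local v)).indicator (fun _ => (1 : ℂ)) g +
      (((νHv ((K'.prod ⊤ : Subgroup ((UnitaryGroup.cmDatum L 2 (Matrix.of fun i j : Fin 2 => if i.val + j.val + 1 = 2 then (1 : L) else 0)).Local v ×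
      (UnitaryGroup.cmDatum L 1 (Matrix.of fun i j : Fin 1 => if i.val + j.val + 1 = 1 then (1 : L) else 0)).Local v)))).toReal : ℂ))⁻¹ * (((K'.prod ⊤ : Subgroup ((UnitaryGroup.cmDatum L 2 (Matrix.of fun i j : Fin 2 => if i.val + j.val + 1 = 2 then (1 : L) else 0)).Local v ×
      (UnitaryGroup.cmDatum L 1 (Matrix.of fun i j : Fin 1 => if i.val + j.val + 1 = 1 then (1 : L) else 0)).Local v))) : Set ((UnitaryGroup.cmDatum L 2 (Matrix.of fun i j : Fin 2 => if i.val + j.val + 1 = 2 then (1 : L) else 0)).Local v ×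
      (UnitaryGroup.cmDatum L 1 (Matrix.of fun i j : Fin 1 => if i.val + j.val + 1 = 1 then (1 : L) else 0)).Local v)).indicator (fun _ => (1 : ℂ)) g -
      (((νHv ((I.prod ⊤ : Subgroup ((UnitaryGroup.cmDatum L 2 (Matrix.of fun i j : Fin 2 => if i.val + j.val + 1 = 2 then (1 : L) else 0)).Local v ×
      (UnitaryGroup.cmDatum L 1 (Matrix.of fun i j : Fin 1 => if i.val + j.val + 1 = 1 then (1 : L) else 0)).Local v)))).toReal : ℂ))⁻¹ * (((I.prod ⊤ : Subgroup ((UnitaryGroup.cmDatum L 2 (Matrix.of fun i j : Fin 2 => if i.val + j.val + 1 = 2 then (1 : L) else 0)).Local v ×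
      (UnitaryGroup.cmDatum L 1 (Matrix.of fun i j : Fin 1 => if i.val + j.val + 1 = 1 then (1 : L) else 0)).Local v))) : Set ((UnitaryGroup.cmDatum L 2 (Matrix.of fun i j : Fin 2 => if i.val + j.val + 1 = 2 then (1 : L) else 0)).Local v ×
      (UnitaryGroup.cmDatum L 1 (Matrix.of fun i j : Fin 1 => if i.val + j.val + 1 = 1 then (1 : L) else 0)).Local v)).indicator (fun _ => (1 : ℂ)) g,
    ?_, ?_, ?_, ?_, ?_, ?_⟩
  · -- locally constant, compactly supported
    exact isLocSmooth_epCombination _ _ _ hK.2 hK.1 hK'.2 hK'.1 hI.2 hI.1 _ _ _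
  · -- measurable
    exact (isLocSmooth_epCombination _ _ _ hK.2 hK.1 hK'.2 hK'.1 hI.2 hI.1 _ _ _).continuous.measurable
  · -- integrable
    exact ((integrable_const_mul_indicator_subgroup L v νHv _ hK.2 hK.1 _).add (integrable_const_mul_indicator_subgroup L v νHv _ hK'.2 hK'.1 _)).sub
      (integrable_const_mul_indicator_subgroup L v νHv _ hI.2 hI.1 _)
  · -- mass one
    have iK := integrable_const_mul_indicator_subgroup L v νHv _ hK.2 hK.1 ((((νHv ((K.prod ⊤ : Subgroup ((UnitaryGroup.cmDatum L 2 (Matrix.of fun i j : Fin 2 => if i.val + j.val + 1 = 2 then (1 : L) else 0)).Local v ×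
      (UnitaryGroup.cmDatum L 1 (Matrix.of fun i j : Fin 1 => if i.val + j.val + 1 = 1 then (1 : L) else 0)).Local v)))).toReal : ℂ))⁻¹)
    have iK' := integrable_const_mul_indicator_subgroup L v νHv _ hK'.2 hK'.1 ((((νHv ((K'.prod ⊤ : Subgroup ((UnitaryGroup.cmDatum L 2 (Matrix.of fun i j : Fin 2 => if i.val + j.val + 1 = 2 then (1 : L) else 0)).Local v ×
      (UnitaryGroup.cmDatum L 1 (Matrix.of fun i j : Fin 1 => if i.val + j.val + 1 = 1 then (1 : L) else 0)).Local v)))).toReal : ℂ))⁻¹)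
    have iI := integrable_const_mul_indicator_subgroup L v νHv _ hI.2 hI.1 ((((νHv ((I.prod ⊤ : Subgroup ((UnitaryGroup.cmDatum L 2 (Matrix.of fun i j : Fin 2 => if i.val + j.val + 1 = 2 then (1 : L) else 0)).Local v ×
      (UnitaryGroup.cmDatum L 1 (Matrix.of fun i j : Fin 1 => if i.val + j.val + 1 = 1 then (1 : L) else 0)).Local v)))).toReal : ℂ))⁻¹)
    have h1 : ∫ h, ((((νHv ((K.prod ⊤ : Subgroup ((UnitaryGroup.cmDatum L 2 (Matrix.of fun i j : Fin 2 => if i.val + j.val + 1 = 2 then (1 : L) else 0)).Local v ×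
      (UnitaryGroup.cmDatum L 1 (Matrix.of fun i j : Fin 1 => if i.val + j.val + 1 = 1 then (1 : L) else 0)).Local v)))).toReal : ℂ))⁻¹ * (((K.prod ⊤ : Subgroup ((UnitaryGroup.cmDatum L 2 (Matrix.of fun i j : Fin 2 => if i.val + j.val + 1 = 2 then (1 : L) else 0)).Local v ×
      (UnitaryGroup.cmDatum L 1 (Matrix.of fun i j : Fin 1 => if i.val + j.val + 1 = 1 then (1 : L) else 0)).Local v))) : Set ((UnitaryGroup.cmDatum L 2 (Matrix.of fun i j : Fin 2 => if i.val + j.val + 1 = 2 then (1 : L) else 0)).Local v ×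
      (UnitaryGroup.cmDatum L 1 (Matrix.of fun i j : Fin 1 => if i.val + j.val + 1 = 1 then (1 : L) else 0)).Local v)).indicator (fun _ => (1 : ℂ)) h +
          (((νHv ((K'.prod ⊤ : Subgroup ((UnitaryGroup.cmDatum L 2 (Matrix.of fun i j : Fin 2 => if i.val + j.val + 1 = 2 then (1 : L) else 0)).Local v ×
      (UnitaryGroup.cmDatum L 1 (Matrix.of fun i j : Fin 1 => if i.val + j.val + 1 = 1 then (1 : L) else 0)).Local v)))).toReal : ℂ))⁻¹ * (((K'.prod ⊤ : Subgroup ((UnitaryGroup.cmDatum L 2 (Matrix.of fun i j : Fin 2 => if i.val + j.val + 1 = 2 then (1 : L) else 0)).Local v ×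
      (UnitaryGroup.cmDatum L 1 (Matrix.of fun i j : Fin 1 => if i.val + j.val + 1 = 1 then (1 : L) else 0)).Local v))) : Set ((UnitaryGroup.cmDatum L 2 (Matrix.of fun i j : Fin 2 => if i.val + j.val + 1 = 2 then (1 : L) else 0)).Local v ×
      (UnitaryGroup.cmDatum L 1 (Matrix.of fun i j : Fin 1 => if i.val + j.val + 1 = 1 then (1 : L) else 0)).Local v)).indicator (fun _ => (1 : ℂ)) h -
          (((νHv ((I.prod ⊤ : Subgroup ((UnitaryGroup.cmDatum L 2 (Matrix.of fun i j : Fin 2 => if i.val + j.val + 1 = 2 then (1 : L) else 0)).Local v ×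
      (UnitaryGroup.cmDatum L 1 (Matrix.of fun i j : Fin 1 => if i.val + j.val + 1 = 1 then (1 : L) else 0)).Local v)))).toReal : ℂ))⁻¹ * (((I.prod ⊤ : Subgroup ((UnitaryGroup.cmDatum L 2 (Matrix.of fun i j : Fin 2 => if i.val + j.val + 1 = 2 then (1 : L) else 0)).Local v ×
      (UnitaryGroup.cmDatum L 1 (Matrix.of fun i j : Fin 1 => if i.val + j.val + 1 = 1 then (1 : L) else 0)).Local v))) : Set ((UnitaryGroup.cmDatum L 2 (Matrix.of fun i j : Fin 2 => if i.val + j.val + 1 = 2 then (1 : L) else 0)).Local v ×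
      (UnitaryGroup.cmDatum L 1 (Matrix.of fun i j : Fin 1 => if i.val + j.val + 1 = 1 then (1 : L) else 0)).Local v)).indicator (fun _ => (1 : ℂ)) h) ∂νHv =
        (∫ h, (((νHv ((K.prod ⊤ : Subgroup ((UnitaryGroup.cmDatum L 2 (Matrix.of fun i j : Fin 2 => if i.val + j.val + 1 = 2 then (1 : L) else 0)).Local v ×
      (UnitaryGroup.cmDatum L 1 (Matrix.of fun i j : Fin 1 => if i.val + j.val + 1 = 1 then (1 : L) else 0)).Local v)))).toReal : ℂ))⁻¹ * (((K.prod ⊤ : Subgroup ((UnitaryGroup.cmDatum L 2 (Matrix.of fun i j : Fin 2 => if i.val + j.val + 1 = 2 then (1 : L) else 0)).Local v ×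
      (UnitaryGroup.cmDatum L 1 (Matrix.of fun i j : Fin 1 => if i.val + j.val + 1 = 1 then (1 : L) else 0)).Local v))) : Set ((UnitaryGroup.cmDatum L 2 (Matrix.of fun i j : Fin 2 => if i.val + j.val + 1 = 2 then (1 : L) else 0)).Local v ×
      (UnitaryGroup.cmDatum L 1 (Matrix.of fun i j : Fin 1 => if i.val + j.val + 1 = 1 then (1 : L) else 0)).Local v)).indicator (fun _ => (1 : ℂ)) h ∂νHv +
          ∫ h, (((νHv ((K'.prod ⊤ : Subgroup ((UnitaryGroup.cmDatum L 2 (Matrix.of fun i j : Fin 2 => if i.val + j.val + 1 = 2 then (1 : L) else 0)).Local v ×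
      (UnitaryGroup.cmDatum L 1 (Matrix.of fun i j : Fin 1 => if i.val + j.val + 1 = 1 then (1 : L) else 0)).Local v)))).toReal : ℂ))⁻¹ * (((K'.prod ⊤ : Subgroup ((UnitaryGroup.cmDatum L 2 (Matrix.of fun i j : Fin 2 => if i.val + j.val + 1 = 2 then (1 : L) else 0)).Local v ×
      (UnitaryGroup.cmDatum L 1 (Matrix.of fun i j : Fin 1 => if i.val + j.val + 1 = 1 then (1 : L) else 0)).Local v))) : Set ((UnitaryGroup.cmDatum L 2 (Matrix.of fun i j : Fin 2 => if i.val + j.val + 1 = 2 then (1 : L) else 0)).Local v ×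
      (UnitaryGroup.cmDatum L 1 (Matrix.of fun i j : Fin 1 => if i.val + j.val + 1 = 1 then (1 : L) else 0)).Local v)).indicator (fun _ => (1 : ℂ)) h ∂νHv) -
          ∫ h, (((νHv ((I.prod ⊤ : Subgroup ((UnitaryGroup.cmDatum L 2 (Matrix.of fun i j : Fin 2 => if i.val + j.val + 1 = 2 then (1 : L) else 0)).Local v ×
      (UnitaryGroup.cmDatum L 1 (Matrix.of fun i j : Fin 1 => if i.val + j.val + 1 = 1 then (1 : L) else 0)).Local v)))).toReal : ℂ))⁻¹ * (((I.prod ⊤ : Subgroup ((UnitaryGroup.cmDatum L 2 (Matrix.of fun i j : Fin 2 => if i.val + j.val + 1 = 2 then (1 : L) else 0)).Local v ×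
      (UnitaryGroup.cmDatum L 1 (Matrix.of fun i j : Fin 1 => if i.val + j.val + 1 = 1 then (1 : L) else 0)).Local v))) : Set ((UnitaryGroup.cmDatum L 2 (Matrix.of fun i j : Fin 2 => if i.val + j.val + 1 = 2 then (1 : L) else 0)).Local v ×
      (UnitaryGroup.cmDatum L 1 (Matrix.of fun i j : Fin 1 => if i.val + j.val + 1 = 1 then (1 : L) else 0)).Local v)).indicator (fun _ => (1 : ℂ)) h ∂νHv := by
      rw [← integral_add iK iK']
      exact integral_sub
        (f := fun h => (((νHv ((K.prod ⊤ : Subgroup ((UnitaryGroup.cmDatum L 2 (Matrix.of fun i j : Fin 2 => if i.val + j.val + 1 = 2 then (1 : L) else 0)).Local v ×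
      (UnitaryGroup.cmDatum L 1 (Matrix.of fun i j : Fin 1 => if i.val + j.val + 1 = 1 then (1 : L) else 0)).Local v)))).toReal : ℂ))⁻¹ * (((K.prod ⊤ : Subgroup ((UnitaryGroup.cmDatum L 2 (Matrix.of fun i j : Fin 2 => if i.val + j.val + 1 = 2 then (1 : L) else 0)).Local v ×
      (UnitaryGroup.cmDatum L 1 (Matrix.of fun i j : Fin 1 => if i.val + j.val + 1 = 1 then (1 : L) else 0)).Local v))) : Set ((UnitaryGroup.cmDatum L 2 (Matrix.of fun i j : Fin 2 => if i.val + j.val + 1 = 2 then (1 : L) else 0)).Local v ×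
      (UnitaryGroup.cmDatum L 1 (Matrix.of fun i j : Fin 1 => if i.val + j.val + 1 = 1 then (1 : L) else 0)).Local v)).indicator (fun _ => (1 : ℂ)) h +
          (((νHv ((K'.prod ⊤ : Subgroup ((UnitaryGroup.cmDatum L 2 (Matrix.of fun i j : Fin 2 => if i.val + j.val + 1 = 2 then (1 : L) else 0)).Local v ×
      (UnitaryGroup.cmDatum L 1 (Matrix.of fun i j : Fin 1 => if i.val + j.val + 1 = 1 then (1 : L) else 0)).Local v)))).toReal : ℂ))⁻¹ * (((K'.prod ⊤ : Subgroup ((UnitaryGroup.cmDatum L 2 (Matrix.of fun i j : Fin 2 => if i.val + j.val + 1 = 2 then (1 : L) else 0)).Local v ×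
      (UnitaryGroup.cmDatum L 1 (Matrix.of fun i j : Fin 1 => if i.val + j.val + 1 = 1 then (1 : L) else 0)).Local v))) : Set ((UnitaryGroup.cmDatum L 2 (Matrix.of fun i j : Fin 2 => if i.val + j.val + 1 = 2 then (1 : L) else 0)).Local v ×
      (UnitaryGroup.cmDatum L 1 (Matrix.of fun i j : Fin 1 => if i.val + j.val + 1 = 1 then (1 : L) else 0)).Local v)).indicator (fun _ => (1 : ℂ)) h)
        (g := fun h => (((νHv ((I.prod ⊤ : Subgroup ((UnitaryGroup.cmDatum L 2 (Matrix.of fun i j : Fin 2 => if i.val + j.val + 1 = 2 then (1 : L) else 0)).Local v ×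
      (UnitaryGroup.cmDatum L 1 (Matrix.of fun i j : Fin 1 => if i.val + j.val + 1 = 1 then (1 : L) else 0)).Local v)))).toReal : ℂ))⁻¹ * (((I.prod ⊤ : Subgroup ((UnitaryGroup.cmDatum L 2 (Matrix.of fun i j : Fin 2 => if i.val + j.val + 1 = 2 then (1 : L) else 0)).Local v ×
      (UnitaryGroup.cmDatum L 1 (Matrix.of fun i j : Fin 1 => if i.val + j.val + 1 = 1 then (1 : L) else 0)).Local v))) : Set ((UnitaryGroup.cmDatum L 2 (Matrix.of fun i j : Fin 2 => if i.val + j.val + 1 = 2 then (1 : L) else 0)).Local v ×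
      (UnitaryGroup.cmDatum L 1 (Matrix.of fun i j : Fin 1 => if i.val + j.val + 1 = 1 then (1 : L) else 0)).Local v)).indicator (fun _ => (1 : ℂ)) h)
        (iK.add iK') iI
    dsimp only
    rw [h1, integral_const_mul_indicator_subgroup L v νHv _ hK.2, integral_const_mul_indicator_subgroup L v νHv _ hK'.2, integral_const_mul_indicator_subgroup L v νHv _ hI.2,
      inv_mul_cancel₀ (hvol _ hK.2 hK.1), inv_mul_cancel₀ (hvol _ hK'.2 hK'.1), inv_mul_cancel₀ (hvol _ hI.2 hI.1)]
    norm_num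
  · -- elliptic `G`-regular classes: (E) on `U₂` read through ★ (B2a)
    intro γH hγ hZc
    haveI : CompactSpace (Subgroup.centralizer ({γH} : Set ((UnitaryGroup.cmDatum L 2 (Matrix.of fun i j : Fin 2 => if i.val + j.val + 1 = 2 then (1 : L) else 0)).Local v ×
      (UnitaryGroup.cmDatum L 1 (Matrix.of fun i j : Fin 1 => if i.val + j.val + 1 = 1 then (1 : L) else 0)).Local v))) := isCompact_iff_compactSpace.1 hZc
    haveI := F0P3cStCharTSEllMassHOrbEll.compactSpace_centralizer_fst_of_centralizerH L v γH
    have hreg := (isRegularElt_fst_snd_of_isLocalGRegular L v γH hγ).1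
    rw [classOrbitalIntegral_epCombination_H L v νHv hcanH _ _ _ hK.2 hK.1 hK'.2 hK'.1 hI.2 hI.1 _ _ _ γH hγ,
      F0P3cStCharTSEllMassHOrbSplit.classOrbitalIntegral_smul_indicator_prod_top_eq_U2_of_isLocalGRegular L v νHv ν₂ hns hcanH hcan₂ K hKo hKc γH hγ,
      F0P3cStCharTSEllMassHOrbSplit.classOrbitalIntegral_smul_indicator_prod_top_eq_U2_of_isLocalGRegular L v νHv ν₂ hns hcanH hcan₂ K' hK'o hK'c γH hγ,
      F0P3cStCharTSEllMassHOrbSplit.classOrbitalIntegral_smul_indicator_prod_top_eq_U2_of_isLocalGRegular L v νHv ν₂ hns hcanH hcan₂ I hIo hIc γH hγ,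
      classOrbitalIntegral_smul_indicator_complex_local_eq_natCard_fixedBy L 2 _ v ν₂ (UnitaryGroup.antidiagOne_isHermitian L 2)
        (UnitaryGroup.isUnit_antidiagOne_det L 2).ne_zero hcan₂ K hKo hKc γH.1 hreg,
      classOrbitalIntegral_smul_indicator_complex_local_eq_natCard_fixedBy L 2 _ v ν₂ (UnitaryGroup.antidiagOne_isHermitian L 2)
        (UnitaryGroup.isUnit_antidiagOne_det L 2).ne_zero hcan₂ K' hK'o hK'c γH.1 hreg,
      classOrbitalIntegral_smul_indicator_complex_local_eq_natCard_fixedBy L 2 _ v ν₂ (UnitaryGroup.antidiagOne_isHermitian L 2)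
        (UnitaryGroup.isUnit_antidiagOne_det L 2).ne_zero hcan₂ I hIo hIc γH.1 hreg]
    have h := hE γH.1 hreg inferInstance
    have h' : (Nat.card (MulAction.fixedBy (((UnitaryGroup.cmDatum L 2 (Matrix.of fun i j : Fin 2 => if i.val + j.val + 1 = 2 then (1 : L) else 0)).Local v) ⧸ K) γH.1) : ℂ) + (Nat.card (MulAction.fixedBy (((UnitaryGroup.cmDatum L 2 (Matrix.of fun i j : Fin 2 => if i.val + j.val + 1 = 2 then (1 : L) else 0)).Local v) ⧸ K') γH.1) : ℂ) =
        (Nat.card (MulAction.fixedBy (((UnitaryGroup.cmDatum L 2 (Matrix.of fun i j : Fin 2 => if i.val + j.val + 1 = 2 then (1 : L) else 0)).Local v) ⧸ I) γH.1) : ℂ) + 1 := by exact_mod_cast h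
    rw [h', add_sub_cancel_left]
  · -- split `G`-regular classes: (N) on `U₂` read through ★ (B2b)
    intro γH hγ hZnc
    have hnc : ¬ CompactSpace (Subgroup.centralizer ({γH.1} : Set ((UnitaryGroup.cmDatum L 2 (Matrix.of fun i j : Fin 2 => if i.val + j.val + 1 = 2 then (1 : L) else 0)).Local v))) := by
      intro hc
      haveI := hc
      have hZH := F0P3cStCharTSEllMassHOrbEll.compactSpace_centralizerH_of_fst L v hns γH
      exact hZnc (isCompact_iff_compactSpace.2 (by exact hZH))
    have hreg := (isRegularElt_fst_snd_of_isLocalGRegular L v γH hγ).1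
    rw [classOrbitalIntegral_epCombination_H L v νHv hcanH _ _ _ hK.2 hK.1 hK'.2 hK'.1 hI.2 hI.1 _ _ _ γH hγ,
      F0P3cStCharTSEllMassHOrbSplit.classOrbitalIntegral_smul_indicator_prod_top_eq_U2_of_isLocalGRegular L v νHv ν₂ hns hcanH hcan₂ K hKo hKc γH hγ,
      F0P3cStCharTSEllMassHOrbSplit.classOrbitalIntegral_smul_indicator_prod_top_eq_U2_of_isLocalGRegular L v νHv ν₂ hns hcanH hcan₂ K' hK'o hK'c γH hγ,
      F0P3cStCharTSEllMassHOrbSplit.classOrbitalIntegral_smul_indicator_prod_top_eq_U2_of_isLocalGRegular L v νHv ν₂ hns hcanH hcan₂ I hIo hIc γH hγ]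
    -- rewrite each `Φ(c⁻¹ · 𝟙_C)` as `c⁻¹ · Φ(𝟙_C)` and use (N)
    have hsm : ∀ (C : Subgroup ((UnitaryGroup.cmDatum L 2 (Matrix.of fun i j : Fin 2 => if i.val + j.val + 1 = 2 then (1 : L) else 0)).Local v)), classOrbitalIntegral m₂ (fun g => (((ν₂ C).toReal : ℂ))⁻¹ * (C : Set ((UnitaryGroup.cmDatum L 2 (Matrix.of fun i j : Fin 2 => if i.val + j.val + 1 = 2 then (1 : L) else 0)).Local v)).indicator (fun _ => (1 : ℂ)) g) (ConjClasses.mk γH.1) =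
        (((ν₂ C).toReal : ℂ))⁻¹ * classOrbitalIntegral m₂ ((C : Set ((UnitaryGroup.cmDatum L 2 (Matrix.of fun i j : Fin 2 => if i.val + j.val + 1 = 2 then (1 : L) else 0)).Local v)).indicator fun _ => (1 : ℂ)) (ConjClasses.mk γH.1) := by
      intro C
      have e : (fun g => (((ν₂ C).toReal : ℂ))⁻¹ * (C : Set ((UnitaryGroup.cmDatum L 2 (Matrix.of fun i j : Fin 2 => if i.val + j.val + 1 = 2 then (1 : L) else 0)).Local v)).indicator (fun _ => (1 : ℂ)) g) = (((ν₂ C).toReal : ℂ))⁻¹ • (C : Set ((UnitaryGroup.cmDatum L 2 (Matrix.of fun i j : Fin 2 => if i.val + j.val + 1 = 2 then (1 : L) else 0)).Local v)).indicator (fun _ => (1 : ℂ)) := by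
        funext g; rw [Pi.smul_apply, smul_eq_mul]
      rw [e, classOrbitalIntegral_eq, orbitalIntegral_smul, ← classOrbitalIntegral_eq, smul_eq_mul]
    rw [hsm K, hsm K', hsm I]
    exact hN γH.1 hreg hnc

end CM

end Summit.HodgeConjecture.HodgeConjecture.Cruxes.H413.F0P3cStCharTSEllMassHEP

end
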